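import Literature.AlgebraicTopology.SingularHomology.FundamentalClassToCoeff
import Literature.AlgebraicTopology.SingularHomology.CapProductPointClass
import Literature.AlgebraicTopology.SingularHomology.UniversalCoefficientsProofs
import Literature.AlgebraicGeometry.HodgeTheory.CanonicalTraceCycleClass
import Literature.AlgebraicGeometry.HodgeTheory.ComplexPointsPoincareDuality
import Literature.AlgebraicGeometry.HodgeTheory.IntegralClassesCountable
import Literature.Geometry.Manifold.DeRhamFundamentalClassPairing
import HarnessLib

/-!
# The trace of an integral generator of the top cohomology of a smooth projective variety is `±1`
# (Poincaré duality over `ℤ`; Hatcher 2002, §3.3 Thm. 3.30 and §3.1 p. 198)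

Layer `Literature/AlgebraicGeometry/HodgeTheory`; THEOREMS ONLY (no definition, no named fact).
For a smooth projective complex variety `X` of dimension `n` and a class `p ∈ H²ⁿ(X(ℂ); ℂ)` which
is INTEGRAL and GENERATES the integral classes (`IsIntegralClass p`, every integral class of `H²ⁿ`
is an integer multiple of `p` — the shape of the clause `(p ≠ 0 ∧ IsIntegralClass p ∧ ∀ q, …)` of the
K3 marking facts `Surfaces.Huybrechts_K3_marking_exists`, `Buskin2019_hodgeIsometry_algebraic`):

* `fundamentalClass_complexOrientationFamily_eq_coeffChange_int` — `[X(ℂ)] = [X(ℂ)]_ℤ ⊗ 1` (the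
  complex fundamental class is the image of the INTEGRAL complex orientation's class; the tree's
  `fundamentalClass_complexOrientationFamily` with `HomologicalOrientation.fundamentalClass_toCoeff`);
* `exists_int_kroneckerPairing_fundamentalClass_eq` — `⟨p, [X(ℂ)]⟩ ∈ ℤ` for `p` integral
  (Hatcher §3.1 p. 198: `⟨β ⊗ 1, z ⊗ 1⟩ = ⟨β, z⟩`);
* `exists_isIntegralClass_kroneckerPairing_fundamentalClass_eq_one` — an integral class with
  `⟨q, [X(ℂ)]⟩ = 1` (Poincaré duality over `ℤ`, Thm. 3.30: `a ↦ a ⌢ [X]` is onto `H₀ ∋ [pt]`);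
* **`kroneckerPairing_fundamentalClass_eq_one_or_eq_neg_one`** — `⟨p, [X(ℂ)]⟩ = ±1` for an integral
  generator `p`; **`traceC_eq_or_eq_neg_of_integral_generator`** — `∫_X p = ± ε₀⁻¹` (`ε₀` the
  universal point sign of `CanonicalTrace`); **`traceC_eq_or_eq_neg_traceC_of_integral_generators`** —
  two integral generators on two smooth projective varieties have traces equal UP TO SIGN.

Consumer: the K3 isogeny-datum programme (`Summits/…/MarkmanPartnerTransportPicardThreeK3SquaresIsogenyDatumTraceSign`:
the relative sign through a roof turns "equal up to sign" into "equal").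

## References

* [HatcherAT2002] A. Hatcher, Algebraic Topology, CUP 2002, §3.1 p. 198, §3.3 Thm. 3.26 and Thm. 3.30.
* [VoisinHodgeI2002] C. Voisin, Hodge Theory and Complex Algebraic Geometry I, CUP 2002, §7.1.1, §11.1.2.
-/

noncomputable section

open CategoryTheory
open Literature.AlgebraicTopology.SingularHomology

namespace Literature.AlgebraicGeometry.HodgeTheory

variable {n : ℕ} {X : Motives.SchemeOver ℂ}

/-- **`[X(ℂ)] = [X(ℂ)]_ℤ ⊗ 1`**: the fundamental class of the complex orientation family is the change
of coefficients `ℤ → ℂ` of the fundamental class of the INTEGRAL complex orientation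
(`[X(ℂ)] = [X(ℂ)]_ℚ ⊗ 1`, `fundamentalClass_complexOrientationFamily`; `[X(ℂ)]_ℚ = [X(ℂ)]_ℤ ⊗ 1`,
`HomologicalOrientation.fundamentalClass_toCoeff`). [cite: HatcherAT2002, §3.3 Thm. 3.26 and p. 235]
[cite: VoisinHodgeI2002, §11.1.2] -/
theorem fundamentalClass_complexOrientationFamily_eq_coeffChange_int (hX : Motives.IsSmoothProjective n X) :
    (complexOrientationFamily hX).fundamentalClass =
      singularHomology.coeffChange (Motives.ComplexPoints X) (algebraMap ℤ ℂ : ℤ →+* ℂ).toAddMonoidHom (2 * n)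
        (complexOrientationInt hX).fundamentalClass := by
  letI := hX.chartedSpace
  haveI := Motives.ComplexPoints.compactSpace_of_isSmoothProjective hX
  haveI := Motives.ComplexPoints.t2Space_of_isSmoothProjective hX
  have hQ : (complexOrientationRat hX).fundamentalClass =
      singularHomology.coeffChange (Motives.ComplexPoints X) (Int.castAddHom ℚ) (2 * n)
        (complexOrientationInt hX).fundamentalClass :=
    HomologicalOrientation.fundamentalClass_toCoeff ℚ (complexOrientationInt hX)
  rw [fundamentalClass_complexOrientationFamily, hQ, singularHomology.coeffChange_comp]
  congr 1

/-- **`⟨p, [X(ℂ)]⟩ ∈ ℤ` for an integral class `p ∈ H²ⁿ(X(ℂ); ℂ)`** (`p = β ⊗ 1`, `[X(ℂ)] = [X(ℂ)]_ℤ ⊗ 1`,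
`⟨β ⊗ 1, z ⊗ 1⟩ = ⟨β, z⟩`). [cite: HatcherAT2002, §3.1 p. 198] -/
theorem exists_int_kroneckerPairing_fundamentalClass_eq (hX : Motives.IsSmoothProjective n X)
    {p : complexBetti X (2 * n)} (hp : IsIntegralClass p) :
    ∃ N : ℤ, kroneckerPairing ℂ ℂ (Motives.ComplexPoints X) (2 * n) p
      (complexOrientationFamily hX).fundamentalClass = (N : ℂ) := by
  obtain ⟨β, rfl⟩ := (isIntegralClass_iff_mem_range_ringChange p).1 hp
  refine ⟨kroneckerPairing ℤ ℤ (Motives.ComplexPoints X) (2 * n) β (complexOrientationInt hX).fundamentalClass, ?_⟩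
  rw [fundamentalClass_complexOrientationFamily_eq_coeffChange_int, ← algebraMap_int_eq,
    Literature.Geometry.Manifold.kroneckerPairing_ringChange_coeffChange ℂ β]
  simp

/-- **An integral class `q ∈ H²ⁿ(X(ℂ); ℂ)` with `⟨q, [X(ℂ)]⟩ = 1`** exists: by Poincaré duality over
`ℤ` (`a ↦ a ⌢ [X(ℂ)]_ℤ` is onto `H₀(X(ℂ); ℤ)`) some `β ∈ H²ⁿ(X(ℂ); ℤ)` has `β ⌢ [X(ℂ)]_ℤ = [pt]`,
whose augmentation is `1`; take `q = β ⊗ 1`. [cite: HatcherAT2002, §3.3 Thm. 3.30 and §3.1 p. 198] -/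
theorem exists_isIntegralClass_kroneckerPairing_fundamentalClass_eq_one (hX : Motives.IsSmoothProjective n X) :
    ∃ q : complexBetti X (2 * n), IsIntegralClass q ∧
      kroneckerPairing ℂ ℂ (Motives.ComplexPoints X) (2 * n) q (complexOrientationFamily hX).fundamentalClass = 1 := by
  haveI := connectedSpace_complexPoints hX
  obtain ⟨x₀⟩ := (inferInstance : Nonempty (Motives.ComplexPoints X))
  -- Poincaré duality over `ℤ`
  have hPD := bijective_poincareDualityMap_of_isSmoothProjective (R := ℤ) hX (complexOrientationInt hX)
    (p := 2 * n) (q := 0) (Nat.add_zero (2 * n))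
  obtain ⟨β, hβ⟩ := hPD.2 (pointClass ℤ 1 x₀)
  have hβ1 : kroneckerPairing ℤ ℤ (Motives.ComplexPoints X) (2 * n) β
      (complexOrientationInt hX).fundamentalClass = 1 := by
    rw [kroneckerPairing_apply, ← poincareDualityMap_apply, hβ, ε_pointClass]
  refine ⟨singularCohomology.ringChange (Int.castRingHom ℂ) (Motives.ComplexPoints X) (2 * n) β,
    (isIntegralClass_iff_mem_range_ringChange _).2 ⟨β, rfl⟩, ?_⟩
  rw [fundamentalClass_complexOrientationFamily_eq_coeffChange_int, ← algebraMap_int_eq,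
    Literature.Geometry.Manifold.kroneckerPairing_ringChange_coeffChange ℂ β, hβ1, map_one]

/-- **`⟨p, [X(ℂ)]⟩ = ±1` for an integral GENERATOR `p` of `H²ⁿ(X(ℂ); ℂ)`**: with `q` integral,
`⟨q, [X(ℂ)]⟩ = 1` and `q = k • p`, `k ∈ ℤ`, one gets `k · ⟨p, [X(ℂ)]⟩ = 1` with `⟨p, [X(ℂ)]⟩ ∈ ℤ`.
[cite: HatcherAT2002, §3.3 Thm. 3.30 and §3.1 p. 198] -/
theorem kroneckerPairing_fundamentalClass_eq_one_or_eq_neg_one (hX : Motives.IsSmoothProjective n X)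
    {p : complexBetti X (2 * n)} (hpint : IsIntegralClass p)
    (hpgen : ∀ q : complexBetti X (2 * n), IsIntegralClass q → ∃ k : ℤ, q = k • p) :
    kroneckerPairing ℂ ℂ (Motives.ComplexPoints X) (2 * n) p (complexOrientationFamily hX).fundamentalClass = 1 ∨
      kroneckerPairing ℂ ℂ (Motives.ComplexPoints X) (2 * n) p (complexOrientationFamily hX).fundamentalClass = -1 := by
  obtain ⟨N, hN⟩ := exists_int_kroneckerPairing_fundamentalClass_eq hX hpint
  obtain ⟨q, hqint, hq1⟩ := exists_isIntegralClass_kroneckerPairing_fundamentalClass_eq_one hX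
  obtain ⟨k, hk⟩ := hpgen q hqint
  have hkN : (k : ℂ) * N = 1 := by
    rw [← hN, ← hq1, hk, map_zsmul, LinearMap.smul_apply, zsmul_eq_mul]
  have hkN' : k * N = 1 := by exact_mod_cast hkN
  rw [hN]
  rcases Int.eq_one_or_neg_one_of_mul_eq_one (by rw [mul_comm]; exact hkN') with h | h
  · left; rw [h]; norm_num
  · right; rw [h]; norm_num

/-- **`∫_X p = ± ε₀⁻¹` for an integral generator `p` of `H²ⁿ(X(ℂ); ℂ)`** (`∫_X = ε₀⁻¹ ⟨·, [X(ℂ)]⟩`,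
`traceC_apply`; `ε₀ = pointSign`). [cite: HatcherAT2002, §3.3 Thm. 3.30] [cite: VoisinHodgeI2002, §11.1.2] -/
theorem traceC_eq_or_eq_neg_of_integral_generator (hX : Motives.IsSmoothProjective n X)
    {p : complexBetti X (2 * n)} (hpint : IsIntegralClass p)
    (hpgen : ∀ q : complexBetti X (2 * n), IsIntegralClass q → ∃ k : ℤ, q = k • p) :
    traceC hX p = ((pointSign : ℂ))⁻¹ ∨ traceC hX p = -((pointSign : ℂ))⁻¹ := by
  rw [traceC_apply]
  rcases kroneckerPairing_fundamentalClass_eq_one_or_eq_neg_one hX hpint hpgen with h | h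
  · left; rw [h, mul_one]
  · right; rw [h, mul_neg_one]

/-- **Two integral generators have the same trace up to sign**: for smooth projective `X`, `Y` (any
dimensions) and integral generators `p ∈ H^{2 dim X}(X(ℂ); ℂ)`, `q ∈ H^{2 dim Y}(Y(ℂ); ℂ)`,
`∫_X p = ∫_Y q` or `∫_X p = -∫_Y q` (both are `± ε₀⁻¹`). [cite: HatcherAT2002, §3.3 Thm. 3.30]
[cite: VoisinHodgeI2002, §11.1.2] -/
theorem traceC_eq_or_eq_neg_traceC_of_integral_generators {m : ℕ} {Y : Motives.SchemeOver ℂ}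
    (hX : Motives.IsSmoothProjective n X) (hY : Motives.IsSmoothProjective m Y)
    {p : complexBetti X (2 * n)} (hpint : IsIntegralClass p)
    (hpgen : ∀ q : complexBetti X (2 * n), IsIntegralClass q → ∃ k : ℤ, q = k • p)
    {q : complexBetti Y (2 * m)} (hqint : IsIntegralClass q)
    (hqgen : ∀ q' : complexBetti Y (2 * m), IsIntegralClass q' → ∃ k : ℤ, q' = k • q) :
    traceC hX p = traceC hY q ∨ traceC hX p = -traceC hY q := by
  rcases traceC_eq_or_eq_neg_of_integral_generator hX hpint hpgen with h | h <;>
    rcases traceC_eq_or_eq_neg_of_integral_generator hY hqint hqgen with h' | h'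
  · left; rw [h, h']
  · right; rw [h, h', neg_neg]
  · right; rw [h, h']
  · left; rw [h, h']

end Literature.AlgebraicGeometry.HodgeTheory

end
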